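import Summits.ValiantsHypothesis.ValiantsHypothesis.Theorems.FreeSubtorusOrbitDimensionBoundStubDiagonalLiftsSchurian
import Literature.Computability.AlgebraicComplexity.BlockDecomposable
import Literature.Computability.AlgebraicComplexity.DetReprEquivalent
import Literature.Computability.AlgebraicComplexity.ApolarityFischerPairing

/-!
# `OrbitDimensionBound` (stmt-ValiantsHypothesis-16133), rung line `square_covering` — stub `stub_stableReduction`,
# part B: splitting an equivariant pencil along an INVARIANT balanced sub-pencil

Helper file (part B of four) for stub 1 `stub_stableReduction` of
`Cruxes/OrbitDimensionBound/Lines/square_covering.lean` (route `FreeSubtorus`).  Part A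
(`…StubStableReductionLattice`) produces, for an equivariant square pencil that is not semisimple, a proper non-zero
balanced sub-pencil `(V, W)` which is invariant under every exact lift pair.  This file turns such a pair into a
TWO-BLOCK SPLIT of the matrix: after a constant base change `P B Q` is block upper triangular with diagonal blocks
`B₁` (`d × d`, `d = dim V`) and `B₂` (`(m - d) × (m - d)`), both affine, `det B₁ · det B₂ = c · det B` (`c ≠ 0`), and —
because the lifts preserve `V` and `W` — every exact lift `B(γ·x) = g B(x) h⁻¹` descends to exact lifts of `B₁` and of
`B₂` (the conjugated gauge matrices are block upper triangular, and block-triangular matrices multiply blockwise).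

Contents: coefficientwise calculus of diagonal substitutions and lifts (`map_coeff_linSubstEntries_diagonal`,
`map_coeff_eq_of_lift`, `map_toLin_map_eq_of_lift`), adapted two-sided base change (`exists_adapted_units`), zero-corner
block calculus along the tree's `cornerEquiv` (`corner_mul`, `submatrix_inl_mul`, `submatrix_inr_mul`), and the split
`exists_twoBlock_split`.

Helper mode (`--supports stmt-ValiantsHypothesis-16133 --as helper`).  Honest framing: [folklore] linear algebra toward
ONE registered stub (`stub_stableReduction`, M) of a dormant rung line whose load-bearing stub `stub_gradedPowerCount` is
OPEN; the crux `OrbitDimensionBound`, the route `FreeSubtorus` and VP ≠ VNP are OPEN and are not moved by this file.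

## References (orientation only)
* A. D. King, Quart. J. Math. 45 (1994), §3.
* [LandsbergRessayre2017] J. M. Landsberg, N. Ressayre, Differential Geom. Appl. 55 (2017), §3, §6.
-/

set_option linter.dupNamespace false

namespace Summit.ValiantsHypothesis.ValiantsHypothesis.Theorems.FreeSubtorusOrbitDimensionBound.SquareCovering.StableReduction

open Matrix MvPolynomial Module
open Literature.Computability.AlgebraicComplexity
open Summit.ValiantsHypothesis.ValiantsHypothesis.Theorems.FreeSubtorusConfusionCovering
open Summit.ValiantsHypothesis.ValiantsHypothesis.Theorems.FreeSubtorusOrbitDimensionBound.SignCovering.PerSummand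

/-! ### §1 Coefficients under diagonal substitutions and exact lifts -/

section Coeff

variable {σ : Type*} [Fintype σ] [DecidableEq σ] {ι : Type*}

/-- A diagonal substitution `x_p ↦ t_p x_p` multiplies the coefficient matrix of `x^e` by the scalar `t^e`. [folklore] -/
theorem map_coeff_linSubstEntries_diagonal (γ : GL σ ℂ) (t : σ → ℂ) (hγ : (γ : Matrix σ σ ℂ) = Matrix.diagonal t)
    (M : Matrix ι ι (MvPolynomial σ ℂ)) (e : σ →₀ ℕ) :
    (Matrix.linSubstEntries γ M).map (coeff e) = (∏ p ∈ e.support, t p ^ e p) • M.map (coeff e) := by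
  ext i j
  simp only [Matrix.map_apply, Matrix.linSubstEntries, hγ, Matrix.smul_apply, smul_eq_mul]
  exact coeff_linSubst_diagonal t (M i j) e

/-- The scalar `t^e` of an invertible diagonal substitution is non-zero. [folklore] -/
theorem prod_pow_ne_zero_of_diagonal (γ : GL σ ℂ) (t : σ → ℂ) (hγ : (γ : Matrix σ σ ℂ) = Matrix.diagonal t)
    (e : σ →₀ ℕ) : (∏ p ∈ e.support, t p ^ e p) ≠ 0 := by
  refine Finset.prod_ne_zero_iff.2 fun p _ => pow_ne_zero _ fun hp => ?_
  have hdet : (γ : Matrix σ σ ℂ).det ≠ 0 := by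
    simpa [Matrix.GeneralLinearGroup.val_det_apply] using (Matrix.GeneralLinearGroup.det γ).ne_zero
  rw [hγ, Matrix.det_diagonal] at hdet
  exact (Finset.prod_ne_zero_iff.1 hdet) p (Finset.mem_univ p) hp

variable [Fintype ι]

/-- **Coefficientwise form of an exact lift** of a diagonal substitution: `B(γ·x) = g B(x) h'` with `γ = diag(t)` reads
`t^e · B_e = g B_e h'` on the coefficient matrix of each monomial `x^e`. [folklore] -/
theorem map_coeff_eq_of_lift (γ : GL σ ℂ) (t : σ → ℂ) (hγ : (γ : Matrix σ σ ℂ) = Matrix.diagonal t)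
    (M : Matrix ι ι (MvPolynomial σ ℂ)) (g h' : Matrix ι ι ℂ)
    (hlift : Matrix.linSubstEntries γ M = g.map C * M * h'.map C) (e : σ →₀ ℕ) :
    (∏ p ∈ e.support, t p ^ e p) • M.map (coeff e) = g * M.map (coeff e) * h' := by
  rw [← map_coeff_linSubstEntries_diagonal γ t hγ M e, hlift, map_coeff_mul_map_C, map_coeff_map_C_mul]

/-- **Lifts are compatible with the pencil** (the hypothesis of the socle dichotomy): for an exact lift
`B(γ·x) = g B(x) h⁻¹` of a diagonal substitution, `B_e (h V) = g (B_e V)` for every subspace `V` and every `e`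
(`B_e h = t^{-e} · g B_e`, and non-zero scalars do not change images). [folklore] -/
theorem map_toLin_map_eq_of_lift {m : ℕ} (γ : GL σ ℂ) (t : σ → ℂ) (hγ : (γ : Matrix σ σ ℂ) = Matrix.diagonal t)
    (M : Matrix (Fin m) (Fin m) (MvPolynomial σ ℂ)) (g h : GL (Fin m) ℂ)
    (hlift : Matrix.linSubstEntries γ M =
      (g : Matrix (Fin m) (Fin m) ℂ).map C * M * ((h⁻¹ : GL (Fin m) ℂ) : Matrix (Fin m) (Fin m) ℂ).map C)
    (e : σ →₀ ℕ) (V : Submodule ℂ (Fin m → ℂ)) :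
    (V.map (Matrix.toLin' (h : Matrix (Fin m) (Fin m) ℂ))).map (Matrix.toLin' (M.map (coeff e))) =
      (V.map (Matrix.toLin' (M.map (coeff e)))).map (Matrix.toLin' (g : Matrix (Fin m) (Fin m) ℂ)) := by
  have h1 := map_coeff_eq_of_lift γ t hγ M _ _ hlift e
  set c : ℂ := ∏ p ∈ e.support, t p ^ e p with hc
  have hc0 : c ≠ 0 := prod_pow_ne_zero_of_diagonal γ t hγ e
  -- `B_e h = c⁻¹ • (g B_e)`
  have h2 : M.map (coeff e) * (h : Matrix (Fin m) (Fin m) ℂ) = c⁻¹ • ((g : Matrix (Fin m) (Fin m) ℂ) * M.map (coeff e)) := by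
    have h3 := congrArg (fun X => c⁻¹ • (X * (h : Matrix (Fin m) (Fin m) ℂ))) h1
    rw [Matrix.smul_mul, smul_smul, inv_mul_cancel₀ hc0, one_smul, Matrix.mul_assoc, ← Units.val_mul,
      inv_mul_cancel, Units.val_one, Matrix.mul_one] at h3
    exact h3
  rw [← Submodule.map_comp, ← Submodule.map_comp, ← Matrix.toLin'_mul, ← Matrix.toLin'_mul, h2,
    LinearEquiv.map_smul, Submodule.map_smul _ _ _ (inv_ne_zero hc0)]

end Coeff

/-! ### §2 Adapted two-sided base change -/

section Adapted

variable {m : ℕ}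

/-- **Adapted two-sided base change.**  For subspaces `V, W ≤ ℂ^m` there are invertible `P, Q` (a basis adapted to `W`
on the row side, a basis adapted to `V` on the column side) such that every constant matrix mapping `V` into `W` becomes
zero in the rows `≥ dim W` and columns `< dim V` after `X ↦ P X Q`, every matrix preserving `W` becomes so after
`X ↦ P X P⁻¹`, and every matrix preserving `V` after `X ↦ Q⁻¹ X Q`. [folklore] -/
theorem exists_adapted_units (V W : Submodule ℂ (Fin m → ℂ)) :
    ∃ P Q : GL (Fin m) ℂ,
      (∀ X : Matrix (Fin m) (Fin m) ℂ, (∀ x ∈ V, X *ᵥ x ∈ W) →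
        ∀ i j : Fin m, finrank ℂ W ≤ (i : ℕ) → (j : ℕ) < finrank ℂ V →
          ((P : Matrix (Fin m) (Fin m) ℂ) * X * (Q : Matrix (Fin m) (Fin m) ℂ)) i j = 0) ∧
      (∀ X : Matrix (Fin m) (Fin m) ℂ, (∀ x ∈ W, X *ᵥ x ∈ W) →
        ∀ i j : Fin m, finrank ℂ W ≤ (i : ℕ) → (j : ℕ) < finrank ℂ W →
          ((P : Matrix (Fin m) (Fin m) ℂ) * X * ((P⁻¹ : GL (Fin m) ℂ) : Matrix (Fin m) (Fin m) ℂ)) i j = 0) ∧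
      (∀ X : Matrix (Fin m) (Fin m) ℂ, (∀ x ∈ V, X *ᵥ x ∈ V) →
        ∀ i j : Fin m, finrank ℂ V ≤ (i : ℕ) → (j : ℕ) < finrank ℂ V →
          (((Q⁻¹ : GL (Fin m) ℂ) : Matrix (Fin m) (Fin m) ℂ) * X * (Q : Matrix (Fin m) (Fin m) ℂ)) i j = 0) := by
  classical
  obtain ⟨bR, hbRmem, hbR⟩ := exists_adaptedBasis m W
  obtain ⟨bC, hbCmem, hbC⟩ := exists_adaptedBasis m V
  set std := Pi.basisFun ℂ (Fin m) with hstd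
  let P : GL (Fin m) ℂ := ⟨bR.toMatrix std, std.toMatrix bR, Module.Basis.toMatrix_mul_toMatrix_flip bR std,
    Module.Basis.toMatrix_mul_toMatrix_flip std bR⟩
  let Q : GL (Fin m) ℂ := ⟨std.toMatrix bC, bC.toMatrix std, Module.Basis.toMatrix_mul_toMatrix_flip std bC,
    Module.Basis.toMatrix_mul_toMatrix_flip bC std⟩
  refine ⟨P, Q, fun X hX i j hi hj => ?_, fun X hX i j hi hj => ?_, fun X hX i j hi hj => ?_⟩
  · change (bR.toMatrix std * X * std.toMatrix bC) i j = 0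
    rw [toMatrix_mul_mul_toMatrix_apply, Matrix.toLin'_apply]
    exact hbR _ (hX _ (hbCmem j hj)) i hi
  · change (bR.toMatrix std * X * std.toMatrix bR) i j = 0
    rw [toMatrix_mul_mul_toMatrix_apply, Matrix.toLin'_apply]
    exact hbR _ (hX _ (hbRmem j hj)) i hi
  · change (bC.toMatrix std * X * std.toMatrix bC) i j = 0
    rw [toMatrix_mul_mul_toMatrix_apply, Matrix.toLin'_apply]
    exact hbC _ (hX _ (hbCmem j hj)) i hi

end Adapted

/-! ### §3 Zero-corner block calculus along `cornerEquiv` -/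

section Corner

variable {R : Type*} [CommRing R] {m d : ℕ}

/-- Matrices with zero lower-left corner (rows `≥ d`, columns `< d`) are closed under multiplication. [folklore] -/
theorem corner_mul {X Y : Matrix (Fin m) (Fin m) R}
    (hX : ∀ i j : Fin m, d ≤ (i : ℕ) → (j : ℕ) < d → X i j = 0)
    (hY : ∀ i j : Fin m, d ≤ (i : ℕ) → (j : ℕ) < d → Y i j = 0) :
    ∀ i j : Fin m, d ≤ (i : ℕ) → (j : ℕ) < d → (X * Y) i j = 0 := by
  intro i j hi hj
  rw [Matrix.mul_apply]
  refine Finset.sum_eq_zero fun k _ => ?_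
  by_cases hk : (k : ℕ) < d
  · rw [hX i k hi hk, zero_mul]
  · rw [hY k j (not_lt.1 hk) hj, mul_zero]

/-- The upper-left block of a product `X Y` with `Y` of zero corner is the product of the upper-left blocks. [folklore] -/
theorem submatrix_inl_mul (hdm : d ≤ m) (X Y : Matrix (Fin m) (Fin m) R)
    (hY : ∀ i j : Fin m, d ≤ (i : ℕ) → (j : ℕ) < d → Y i j = 0) :
    (X * Y).submatrix (fun i => cornerEquiv d m hdm (Sum.inl i)) (fun j => cornerEquiv d m hdm (Sum.inl j)) =
      X.submatrix (fun i => cornerEquiv d m hdm (Sum.inl i)) (fun j => cornerEquiv d m hdm (Sum.inl j)) *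
        Y.submatrix (fun i => cornerEquiv d m hdm (Sum.inl i)) (fun j => cornerEquiv d m hdm (Sum.inl j)) := by
  ext a b
  simp only [Matrix.submatrix_apply, Matrix.mul_apply]
  rw [← Equiv.sum_comp (cornerEquiv d m hdm), Fintype.sum_sum_type]
  have h0 : ∑ c : Fin (m - d), X (cornerEquiv d m hdm (Sum.inl a)) (cornerEquiv d m hdm (Sum.inr c)) *
      Y (cornerEquiv d m hdm (Sum.inr c)) (cornerEquiv d m hdm (Sum.inl b)) = 0 :=
    Finset.sum_eq_zero fun c _ => by
      rw [hY _ _ (by rw [cornerEquiv_inr_val]; omega) (by rw [cornerEquiv_inl_val]; exact b.2), mul_zero]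
  rw [h0, add_zero]

/-- The lower-right block of a product `X Y` with `X` of zero corner is the product of the lower-right blocks.
[folklore] -/
theorem submatrix_inr_mul (hdm : d ≤ m) (X Y : Matrix (Fin m) (Fin m) R)
    (hX : ∀ i j : Fin m, d ≤ (i : ℕ) → (j : ℕ) < d → X i j = 0) :
    (X * Y).submatrix (fun i => cornerEquiv d m hdm (Sum.inr i)) (fun j => cornerEquiv d m hdm (Sum.inr j)) =
      X.submatrix (fun i => cornerEquiv d m hdm (Sum.inr i)) (fun j => cornerEquiv d m hdm (Sum.inr j)) *
        Y.submatrix (fun i => cornerEquiv d m hdm (Sum.inr i)) (fun j => cornerEquiv d m hdm (Sum.inr j)) := by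
  ext a b
  simp only [Matrix.submatrix_apply, Matrix.mul_apply]
  rw [← Equiv.sum_comp (cornerEquiv d m hdm), Fintype.sum_sum_type]
  have h0 : ∑ c : Fin d, X (cornerEquiv d m hdm (Sum.inr a)) (cornerEquiv d m hdm (Sum.inl c)) *
      Y (cornerEquiv d m hdm (Sum.inl c)) (cornerEquiv d m hdm (Sum.inr b)) = 0 :=
    Finset.sum_eq_zero fun c _ => by
      rw [hX _ _ (by rw [cornerEquiv_inr_val]; omega) (by rw [cornerEquiv_inl_val]; exact c.2), zero_mul]
  rw [h0, zero_add]

/-- The blocks of the identity are identities. [folklore] -/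
theorem submatrix_inl_one (hdm : d ≤ m) :
    (1 : Matrix (Fin m) (Fin m) R).submatrix (fun i => cornerEquiv d m hdm (Sum.inl i))
      (fun j => cornerEquiv d m hdm (Sum.inl j)) = 1 :=
  Matrix.submatrix_one _ ((cornerEquiv d m hdm).injective.comp Sum.inl_injective)

/-- The blocks of the identity are identities. [folklore] -/
theorem submatrix_inr_one (hdm : d ≤ m) :
    (1 : Matrix (Fin m) (Fin m) R).submatrix (fun i => cornerEquiv d m hdm (Sum.inr i))
      (fun j => cornerEquiv d m hdm (Sum.inr j)) = 1 :=
  Matrix.submatrix_one _ ((cornerEquiv d m hdm).injective.comp Sum.inr_injective)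

/-- **Diagonal blocks of a block-triangular invertible matrix are invertible**: if `G` and `G⁻¹` both have zero corner,
the upper-left blocks of `G` and `G⁻¹` are mutually inverse, and so are the lower-right blocks. [folklore] -/
theorem exists_units_blocks (hdm : d ≤ m) (G : GL (Fin m) R)
    (hG : ∀ i j : Fin m, d ≤ (i : ℕ) → (j : ℕ) < d → (G : Matrix (Fin m) (Fin m) R) i j = 0)
    (hG' : ∀ i j : Fin m, d ≤ (i : ℕ) → (j : ℕ) < d → ((G⁻¹ : GL (Fin m) R) : Matrix (Fin m) (Fin m) R) i j = 0) :
    ∃ (G₁ : GL (Fin d) R) (G₂ : GL (Fin (m - d)) R),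
      (G₁ : Matrix (Fin d) (Fin d) R) =
        (G : Matrix (Fin m) (Fin m) R).submatrix (fun i => cornerEquiv d m hdm (Sum.inl i))
          (fun j => cornerEquiv d m hdm (Sum.inl j)) ∧
      ((G₁⁻¹ : GL (Fin d) R) : Matrix (Fin d) (Fin d) R) =
        ((G⁻¹ : GL (Fin m) R) : Matrix (Fin m) (Fin m) R).submatrix (fun i => cornerEquiv d m hdm (Sum.inl i))
          (fun j => cornerEquiv d m hdm (Sum.inl j)) ∧
      (G₂ : Matrix (Fin (m - d)) (Fin (m - d)) R) =
        (G : Matrix (Fin m) (Fin m) R).submatrix (fun i => cornerEquiv d m hdm (Sum.inr i))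
          (fun j => cornerEquiv d m hdm (Sum.inr j)) ∧
      ((G₂⁻¹ : GL (Fin (m - d)) R) : Matrix (Fin (m - d)) (Fin (m - d)) R) =
        ((G⁻¹ : GL (Fin m) R) : Matrix (Fin m) (Fin m) R).submatrix (fun i => cornerEquiv d m hdm (Sum.inr i))
          (fun j => cornerEquiv d m hdm (Sum.inr j)) := by
  have hGG' : (G : Matrix (Fin m) (Fin m) R) * ((G⁻¹ : GL (Fin m) R) : Matrix (Fin m) (Fin m) R) = 1 := by
    rw [← Units.val_mul, mul_inv_cancel, Units.val_one]
  have hG'G : ((G⁻¹ : GL (Fin m) R) : Matrix (Fin m) (Fin m) R) * (G : Matrix (Fin m) (Fin m) R) = 1 := by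
    rw [← Units.val_mul, inv_mul_cancel, Units.val_one]
  have h1 : (G : Matrix (Fin m) (Fin m) R).submatrix (fun i => cornerEquiv d m hdm (Sum.inl i))
        (fun j => cornerEquiv d m hdm (Sum.inl j)) *
      ((G⁻¹ : GL (Fin m) R) : Matrix (Fin m) (Fin m) R).submatrix (fun i => cornerEquiv d m hdm (Sum.inl i))
        (fun j => cornerEquiv d m hdm (Sum.inl j)) = 1 := by
    rw [← submatrix_inl_mul hdm _ _ hG', hGG', submatrix_inl_one]
  have h2 : ((G⁻¹ : GL (Fin m) R) : Matrix (Fin m) (Fin m) R).submatrix (fun i => cornerEquiv d m hdm (Sum.inl i))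
        (fun j => cornerEquiv d m hdm (Sum.inl j)) *
      (G : Matrix (Fin m) (Fin m) R).submatrix (fun i => cornerEquiv d m hdm (Sum.inl i))
        (fun j => cornerEquiv d m hdm (Sum.inl j)) = 1 := by
    rw [← submatrix_inl_mul hdm _ _ hG, hG'G, submatrix_inl_one]
  have h3 : (G : Matrix (Fin m) (Fin m) R).submatrix (fun i => cornerEquiv d m hdm (Sum.inr i))
        (fun j => cornerEquiv d m hdm (Sum.inr j)) *
      ((G⁻¹ : GL (Fin m) R) : Matrix (Fin m) (Fin m) R).submatrix (fun i => cornerEquiv d m hdm (Sum.inr i))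
        (fun j => cornerEquiv d m hdm (Sum.inr j)) = 1 := by
    rw [← submatrix_inr_mul hdm _ _ hG, hGG', submatrix_inr_one]
  have h4 : ((G⁻¹ : GL (Fin m) R) : Matrix (Fin m) (Fin m) R).submatrix (fun i => cornerEquiv d m hdm (Sum.inr i))
        (fun j => cornerEquiv d m hdm (Sum.inr j)) *
      (G : Matrix (Fin m) (Fin m) R).submatrix (fun i => cornerEquiv d m hdm (Sum.inr i))
        (fun j => cornerEquiv d m hdm (Sum.inr j)) = 1 := by
    rw [← submatrix_inr_mul hdm _ _ hG', hG'G, submatrix_inr_one]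
  exact ⟨⟨_, _, h1, h2⟩, ⟨_, _, h3, h4⟩, rfl, rfl, rfl, rfl⟩

end Corner

/-! ### §4 The two-block split -/

section Split

variable {σ : Type*} [Fintype σ] [DecidableEq σ] {m : ℕ}

omit [Fintype σ] [DecidableEq σ] in
/-- Zero corners survive the inclusion of constants. [folklore] -/
theorem corner_map_C {d : ℕ} {X : Matrix (Fin m) (Fin m) ℂ}
    (hX : ∀ i j : Fin m, d ≤ (i : ℕ) → (j : ℕ) < d → X i j = 0) :
    ∀ i j : Fin m, d ≤ (i : ℕ) → (j : ℕ) < d → (X.map C : Matrix (Fin m) (Fin m) (MvPolynomial σ ℂ)) i j = 0 := by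
  intro i j hi hj
  rw [Matrix.map_apply, hX i j hi hj, C_0]

/-- An automorphism `g` with `g W = W` maps `W` into itself, and so does `g⁻¹`. [folklore] -/
theorem mulVec_mem_of_map_eq (g : GL (Fin m) ℂ) (W : Submodule ℂ (Fin m → ℂ))
    (hW : W.map (Matrix.toLin' (g : Matrix (Fin m) (Fin m) ℂ)) = W) :
    (∀ x ∈ W, (g : Matrix (Fin m) (Fin m) ℂ) *ᵥ x ∈ W) ∧
      ∀ x ∈ W, ((g⁻¹ : GL (Fin m) ℂ) : Matrix (Fin m) (Fin m) ℂ) *ᵥ x ∈ W := by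
  constructor
  · intro x hx
    have h1 : Matrix.toLin' (g : Matrix (Fin m) (Fin m) ℂ) x ∈ W.map (Matrix.toLin' (g : Matrix (Fin m) (Fin m) ℂ)) :=
      Submodule.mem_map_of_mem hx
    rw [hW, Matrix.toLin'_apply] at h1
    exact h1
  · intro x hx
    rw [← hW] at hx
    obtain ⟨y, hy, rfl⟩ := Submodule.mem_map.1 hx
    rw [Matrix.toLin'_apply, Matrix.mulVec_mulVec, ← Units.val_mul, inv_mul_cancel, Units.val_one, Matrix.one_mulVec]
    exact hy

/-- **Two-block split along an invariant balanced sub-pencil.**  Let `B` be an affine `m × m` pencil and `(V, W)` a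
sub-pencil (`B_e V ⊆ W` for every coefficient matrix) with `dim V = dim W = d ≤ m`, and let `D` be a set of
substitutions each of which lifts exactly to `B` by a pair `(g, h)` with `h V = V` and `g W = W`.  Then there are affine
matrices `B₁` (`d × d`) and `B₂` (`(m-d) × (m-d)`) with `det B₁ · det B₂ = c · det B`, `c ≠ 0`, to each of which every
`γ ∈ D` lifts exactly (the diagonal blocks of `P B Q` in adapted bases; the conjugated gauge matrices are block
triangular). [folklore] -/
theorem exists_twoBlock_split (B : Matrix (Fin m) (Fin m) (MvPolynomial σ ℂ)) (hBaff : ∀ i j, (B i j).totalDegree ≤ 1)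
    (V W : Submodule ℂ (Fin m → ℂ))
    (hVW : ∀ (e : σ →₀ ℕ) (x : Fin m → ℂ), x ∈ V → Matrix.toLin' (B.map (coeff e)) x ∈ W)
    (hd : finrank ℂ W = finrank ℂ V) (hdm : finrank ℂ V ≤ m) (D : Set (GL σ ℂ))
    (hlift : ∀ γ ∈ D, ∃ g h : GL (Fin m) ℂ,
        Matrix.linSubstEntries γ B =
            (g : Matrix (Fin m) (Fin m) ℂ).map C * B * ((h⁻¹ : GL (Fin m) ℂ) : Matrix (Fin m) (Fin m) ℂ).map C ∧
          V.map (Matrix.toLin' (h : Matrix (Fin m) (Fin m) ℂ)) = V ∧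
          W.map (Matrix.toLin' (g : Matrix (Fin m) (Fin m) ℂ)) = W) :
    ∃ (B₁ : Matrix (Fin (finrank ℂ V)) (Fin (finrank ℂ V)) (MvPolynomial σ ℂ))
      (B₂ : Matrix (Fin (m - finrank ℂ V)) (Fin (m - finrank ℂ V)) (MvPolynomial σ ℂ)),
      (∀ i j, (B₁ i j).totalDegree ≤ 1) ∧ (∀ i j, (B₂ i j).totalDegree ≤ 1) ∧
      (∃ c : ℂ, c ≠ 0 ∧ B₁.det * B₂.det = C c * B.det) ∧
      (∀ γ ∈ D, ∃ g h : GL (Fin (finrank ℂ V)) ℂ, Matrix.linSubstEntries γ B₁ =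
          (g : Matrix (Fin (finrank ℂ V)) (Fin (finrank ℂ V)) ℂ).map C * B₁ *
            ((h⁻¹ : GL (Fin (finrank ℂ V)) ℂ) : Matrix (Fin (finrank ℂ V)) (Fin (finrank ℂ V)) ℂ).map C) ∧
      (∀ γ ∈ D, ∃ g h : GL (Fin (m - finrank ℂ V)) ℂ, Matrix.linSubstEntries γ B₂ =
          (g : Matrix (Fin (m - finrank ℂ V)) (Fin (m - finrank ℂ V)) ℂ).map C * B₂ *
            ((h⁻¹ : GL (Fin (m - finrank ℂ V)) ℂ) :
              Matrix (Fin (m - finrank ℂ V)) (Fin (m - finrank ℂ V)) ℂ).map C) := by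
  classical
  obtain ⟨P, Q, hPQ, hPP, hQQ⟩ := exists_adapted_units V W
  set d := finrank ℂ V with hd_def
  set Bt : Matrix (Fin m) (Fin m) (MvPolynomial σ ℂ) :=
    (P : Matrix (Fin m) (Fin m) ℂ).map C * B * (Q : Matrix (Fin m) (Fin m) ℂ).map C with hBt
  -- the zero corner of `Bt`
  have hcorner : ∀ i j : Fin m, d ≤ (i : ℕ) → (j : ℕ) < d → Bt i j = 0 := by
    intro i j hi hj
    refine apply_eq_zero_of_forall_map_coeff _ i j fun e => ?_
    rw [hBt, map_coeff_mul_map_C, map_coeff_map_C_mul]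
    refine hPQ _ (fun x hx => ?_) i j (by rw [hd]; exact hi) hj
    rw [← Matrix.toLin'_apply]
    exact hVW e x hx
  have hPdet : (P : Matrix (Fin m) (Fin m) ℂ).det ≠ 0 := by
    simpa [Matrix.GeneralLinearGroup.val_det_apply] using (Matrix.GeneralLinearGroup.det P).ne_zero
  have hQdet : (Q : Matrix (Fin m) (Fin m) ℂ).det ≠ 0 := by
    simpa [Matrix.GeneralLinearGroup.val_det_apply] using (Matrix.GeneralLinearGroup.det Q).ne_zero
  refine ⟨Bt.submatrix (fun i => cornerEquiv d m hdm (Sum.inl i)) (fun j => cornerEquiv d m hdm (Sum.inl j)),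
    Bt.submatrix (fun i => cornerEquiv d m hdm (Sum.inr i)) (fun j => cornerEquiv d m hdm (Sum.inr j)),
    fun i j => totalDegree_map_C_mul_mul_map_C_le _ _ hBaff _ _,
    fun i j => totalDegree_map_C_mul_mul_map_C_le _ _ hBaff _ _,
    ⟨(P : Matrix (Fin m) (Fin m) ℂ).det * (Q : Matrix (Fin m) (Fin m) ℂ).det, mul_ne_zero hPdet hQdet, ?_⟩,
    fun γ hγ => ?_, fun γ hγ => ?_⟩
  · rw [← det_eq_mul_det_of_corner_eq_zero hdm Bt hcorner, hBt, det_map_C_mul_mul_map_C]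
  all_goals
    obtain ⟨g, h, hgh, hV, hW⟩ := hlift γ hγ
    obtain ⟨hgW, hg'W⟩ := mulVec_mem_of_map_eq g W hW
    obtain ⟨hhV, hh'V⟩ := mulVec_mem_of_map_eq h V hV
    -- conjugated gauge matrices and the lift of `γ` to `Bt`
    have hliftt : Matrix.linSubstEntries γ Bt =
        ((P * g * P⁻¹ : GL (Fin m) ℂ) : Matrix (Fin m) (Fin m) ℂ).map C * Bt *
          (((Q⁻¹ * h * Q)⁻¹ : GL (Fin m) ℂ) : Matrix (Fin m) (Fin m) ℂ).map C := by
      rw [hBt, Matrix.linSubstEntries_mul, Matrix.linSubstEntries_mul, Matrix.linSubstEntries_map_C,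
        Matrix.linSubstEntries_map_C, hgh]
      simp only [_root_.mul_inv_rev, inv_inv, Units.val_mul, Matrix.map_mul, Matrix.mul_assoc,
        inv_map_C_mul_cancel_left, map_C_mul_inv_cancel_left]
    have hGc : ∀ i j : Fin m, d ≤ (i : ℕ) → (j : ℕ) < d →
        ((P * g * P⁻¹ : GL (Fin m) ℂ) : Matrix (Fin m) (Fin m) ℂ) i j = 0 := fun i j hi hj => by
      rw [Units.val_mul, Units.val_mul]
      exact hPP _ hgW i j (by rw [hd]; exact hi) (by rw [hd]; exact hj)
    have hG'c : ∀ i j : Fin m, d ≤ (i : ℕ) → (j : ℕ) < d →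
        (((P * g * P⁻¹)⁻¹ : GL (Fin m) ℂ) : Matrix (Fin m) (Fin m) ℂ) i j = 0 := fun i j hi hj => by
      rw [_root_.mul_inv_rev, _root_.mul_inv_rev, inv_inv, ← mul_assoc, Units.val_mul, Units.val_mul]
      exact hPP _ hg'W i j (by rw [hd]; exact hi) (by rw [hd]; exact hj)
    have hHc : ∀ i j : Fin m, d ≤ (i : ℕ) → (j : ℕ) < d →
        ((Q⁻¹ * h * Q : GL (Fin m) ℂ) : Matrix (Fin m) (Fin m) ℂ) i j = 0 := fun i j hi hj => by
      rw [Units.val_mul, Units.val_mul]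
      exact hQQ _ hhV i j hi hj
    have hH'c : ∀ i j : Fin m, d ≤ (i : ℕ) → (j : ℕ) < d →
        (((Q⁻¹ * h * Q)⁻¹ : GL (Fin m) ℂ) : Matrix (Fin m) (Fin m) ℂ) i j = 0 := fun i j hi hj => by
      rw [_root_.mul_inv_rev, _root_.mul_inv_rev, inv_inv, ← mul_assoc, Units.val_mul, Units.val_mul]
      exact hQQ _ hh'V i j hi hj
    obtain ⟨G₁, G₂, hG₁, hG₁', hG₂, hG₂'⟩ := exists_units_blocks hdm _ hGc hG'c
    obtain ⟨H₁, H₂, hH₁, hH₁', hH₂, hH₂'⟩ := exists_units_blocks hdm _ hHc hH'c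
  · refine ⟨G₁, H₁, ?_⟩
    rw [hG₁, hH₁', ← Matrix.submatrix_map, ← Matrix.submatrix_map,
      ← submatrix_inl_mul hdm _ _ hcorner, ← submatrix_inl_mul hdm _ _ (corner_map_C hH'c), ← hliftt]
    rfl
  · refine ⟨G₂, H₂, ?_⟩
    rw [hG₂, hH₂', ← Matrix.submatrix_map, ← Matrix.submatrix_map,
      ← submatrix_inr_mul hdm _ _ (corner_map_C hGc),
      ← submatrix_inr_mul hdm _ _ (corner_mul (corner_map_C hGc) hcorner), ← hliftt]
    rfl

end Split

end Summit.ValiantsHypothesis.ValiantsHypothesis.Theorems.FreeSubtorusOrbitDimensionBound.SquareCovering.StableReduction
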